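import Summits.Ventures.DiscreteObjects.Hadamard.ConferenceGraph333FixedConference

/-!
# Partial Hadamard matrices from extremal fixed subgraphs of srg(333,166,82,83): the `F × (V ∖ F)` Seidel block has
# orthogonal rows with zero sums (kernel; dictionary for the ℤ/11, ℤ/7, ℤ/5, ℤ/3 structured families)

Framing: lottery ticket; floor = certified bounds/negative ranges.  Cell pub-namedobj (venture DiscreteObjects),
target (H) = `H(668)`, hadamard gen 31.  When the fixed set `F` of an automorphism `σ` induces a CONFERENCE GRAPH (gen 30,
`ConferenceGraph333FixedConference`: order `11` ⇒ `srg(25,12,5,6)` (forced), order `7` with `f = 25`, order `5` with `f = 13` ⇒ `P(13)`-type,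
order `3` or `27` with `f = 9` ⇒ `srg(9,4,1,2)`), the rows of the Seidel matrix `S = J − I − 2A` indexed by `F` and restricted to the
MOVED vertices are pairwise orthogonal with zero sums, and every fixed vertex sees each `⟨σ⟩`-orbit entirely or not at all:
* `fixed_conference_block` — the arithmetic core: if `|F| = f = 2k' + 1 = 4μ' + 1`, `deg_F ≡ k'`, and on `F` adjacent pairs have `μ' − 1`,
  non-adjacent pairs `μ'` common `F`-neighbours, then for `y ∈ F`: `Σ_{z ∉ F} A_{yz} = 166 − k'`, `Σ_{z∉F} (1 − 2A_{yz}) = 0`, and for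
  `y ≠ y' ∈ F`: `Σ_{z ∉ F} A_{yz}A_{zy'} = 83 − μ'`, `Σ_{z∉F} (1 − 2A_{yz})(1 − 2A_{y'z}) = 0`;
* `aut_fixed_row_orbit_constant` — `A_{y,σz} = A_{yz}` for `σy = y` (so the `F`-rows are constant on `⟨σ⟩`-orbits);
* **`aut_order11_fixed_block`** — order `11`: every fixed vertex has exactly `154 = 14·11` moved neighbours (it is joined to exactly `14` of
  the `28` orbits of size `11`), two distinct fixed vertices have exactly `77 = 7·11` common moved neighbours (`7` common orbits), and the
  `25` Seidel rows on the `308` moved vertices are orthogonal with zero sums: compressed to the `28` orbits, `B = (A_{y,O})` is a `25 × 28`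
  `0/1` matrix with `B𝟙 = 14·𝟙`, `BBᵀ = 7(I + J)`, i.e. `[𝟙; 2B − J]` is a **`26 × 28` PARTIAL HADAMARD MATRIX** — the incidence
  skeleton of the ℤ/11 structured family;
* `aut_order7_fixed25_block` (`26 × 44`), `aut_order5_fixed13_block` (`14 × 64`), `aut_order3_fixed9_block` (`10 × 108`) likewise.
WORDS: structure of a HYPOTHETICAL object (dictionary lines; nothing about H(668) is excluded); orbit-matrix method in print
(Behbahani–Lam 2011), instance and kernel proofs ours (PROVISIONAL).  No `sorry`, no new definitions.
-/

namespace Summit.Ventures.DiscreteObjects.Hadamard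

open Finset

section fixedBlock
variable {V : Type*} [Fintype V] [DecidableEq V]

/-- **Arithmetic core.**  A vertex set `F` inducing a conference-type subgraph inside `srg(333,166,82,83)`: the `F × (V ∖ F)` block of
`A` has row sums `166 − k'` and inner products `83 − μ'`, and the corresponding Seidel block has zero row sums and orthogonal rows. -/
theorem fixed_conference_block (hV : Fintype.card V = 333) (A : Matrix V V ℤ)
    (h01 : ∀ x y, A x y = 0 ∨ A x y = 1) (hsymm : ∀ x y, A y x = A x y)
    (hk : ∀ x, ∑ y, A x y = 166) (hsrg : ∀ x y, ∑ z, A x z * A z y = 83 * (1 + (if x = y then 1 else 0)) - A x y)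
    (F : Finset V) {k' μ' : ℤ} (hf1 : (F.card : ℤ) = 2 * k' + 1) (hf2 : (F.card : ℤ) = 4 * μ' + 1)
    (hdeg : ∀ y ∈ F, ∑ z ∈ F, A y z = k')
    (hlm : ∀ y ∈ F, ∀ y' ∈ F, y ≠ y' → ∑ z ∈ F, A y z * A z y' = (if A y y' = 1 then μ' - 1 else μ')) :
    (∀ y ∈ F, ∑ z ∈ univ \ F, A y z = 166 - k' ∧ ∑ z ∈ univ \ F, (1 - 2 * A y z) = 0) ∧
    (∀ y ∈ F, ∀ y' ∈ F, y ≠ y' →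
      ∑ z ∈ univ \ F, A y z * A z y' = 83 - μ' ∧ ∑ z ∈ univ \ F, (1 - 2 * A y z) * (1 - 2 * A y' z) = 0) := by
  have hsplit : ∀ G : V → ℤ, ∑ z, G z = ∑ z ∈ F, G z + ∑ z ∈ univ \ F, G z := fun G => by
    rw [← Finset.sum_union (Finset.disjoint_sdiff), Finset.union_sdiff_of_subset (Finset.subset_univ F)]
  have hMcard : ((univ \ F).card : ℤ) = 333 - F.card := by
    rw [Finset.card_sdiff_of_subset (Finset.subset_univ F), Finset.card_univ, hV,
      Nat.cast_sub (by rw [← hV]; exact Finset.card_le_univ F)]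
    norm_num
  have hrow : ∀ y ∈ F, ∑ z ∈ univ \ F, A y z = 166 - k' := by
    intro y hy
    have h := hsplit (fun z => A y z)
    rw [hk y, hdeg y hy] at h
    linarith
  refine ⟨fun y hy => ⟨hrow y hy, ?_⟩, fun y hy y' hy' hne => ?_⟩
  · rw [Finset.sum_sub_distrib, Finset.sum_const, nsmul_eq_mul, mul_one, ← Finset.mul_sum, hrow y hy, hMcard]
    linarith
  · have hpair : ∑ z ∈ univ \ F, A y z * A z y' = 83 - μ' := by
      have h := hsplit (fun z => A y z * A z y')
      rw [hsrg y y', if_neg hne, hlm y hy y' hy' hne] at h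
      rcases h01 y y' with e | e <;> rw [e] at h <;> norm_num at h ⊢ <;> linarith
    refine ⟨hpair, ?_⟩
    have e : ∀ z, (1 - 2 * A y z) * (1 - 2 * A y' z) = 1 - 2 * A y z - 2 * A y' z + 4 * (A y z * A z y') := by
      intro z; rw [hsymm z y']; ring
    rw [Finset.sum_congr rfl fun z _ => e z, Finset.sum_add_distrib, Finset.sum_sub_distrib, Finset.sum_sub_distrib,
      Finset.sum_const, nsmul_eq_mul, mul_one, ← Finset.mul_sum, ← Finset.mul_sum, ← Finset.mul_sum, hrow y hy, hrow y' hy',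
      hpair, hMcard]
    linarith

omit [Fintype V] [DecidableEq V] in
/-- For a fixed vertex `y` of `σ`, the row `A_{y,·}` is `σ`-invariant: `A_{y,σz} = A_{yz}` (so it is constant on `⟨σ⟩`-orbits). -/
theorem aut_fixed_row_orbit_constant (A : Matrix V V ℤ) (σ : Equiv.Perm V) (hA : ∀ x y, A (σ x) (σ y) = A x y)
    {y : V} (hy : σ y = y) (z : V) (j : ℕ) : A y ((σ ^ j) z) = A y z := by
  induction j with
  | zero => simp
  | succ j ih =>
    rw [pow_succ', Equiv.Perm.mul_apply]
    conv_lhs => rw [← hy]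
    rw [hA, ih]

omit [Fintype V] in
/-- the fixed-srg conclusion shape of gen 30 gives the hypotheses of `fixed_conference_block` -/
private theorem hlm_of_fixed_srg (A : Matrix V V ℤ) (F : Finset V) {k' l' m' : ℤ}
    (h : ∀ x ∈ F, ∀ y ∈ F, ∑ z ∈ F, A x z * A z y = (if x = y then k' else if A x y = 1 then l' else m'))
    (hl : l' = m' - 1) :
    ∀ y ∈ F, ∀ y' ∈ F, y ≠ y' → ∑ z ∈ F, A y z * A z y' = (if A y y' = 1 then m' - 1 else m') := by
  intro y hy y' hy' hne
  rw [h y hy y' hy', if_neg hne, hl]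

/-- **Order `11`: the `25 × 308` fixed-by-moved block** — `154` moved neighbours per fixed vertex (`14` whole orbits of size `11`),
`77` common moved neighbours for two fixed vertices (`7` common orbits), orthogonal Seidel rows with zero sums, rows constant on orbits:
compressed, a `26 × 28` partial Hadamard matrix `[𝟙; 2B − J]`. -/
theorem aut_order11_fixed_block (hV : Fintype.card V = 333) (A : Matrix V V ℤ)
    (h01 : ∀ x y, A x y = 0 ∨ A x y = 1) (hsymm : ∀ x y, A y x = A x y) (hdiag : ∀ x, A x x = 0)
    (hk : ∀ x, ∑ y, A x y = 166) (hsrg : ∀ x y, ∑ z, A x z * A z y = 83 * (1 + (if x = y then 1 else 0)) - A x y)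
    (σ : Equiv.Perm V) (hσ : σ ^ 11 = 1) (hσ1 : σ ≠ 1) (hA : ∀ x y, A (σ x) (σ y) = A x y) :
    (univ.filter fun x => σ x = x).card = 25 ∧ ((univ \ univ.filter fun x => σ x = x).card = 308) ∧
    (∀ y ∈ univ.filter (fun x => σ x = x),
      ∑ z ∈ univ \ univ.filter (fun x => σ x = x), A y z = 154 ∧
      ∑ z ∈ univ \ univ.filter (fun x => σ x = x), (1 - 2 * A y z) = 0) ∧
    (∀ y ∈ univ.filter (fun x => σ x = x), ∀ y' ∈ univ.filter (fun x => σ x = x), y ≠ y' →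
      ∑ z ∈ univ \ univ.filter (fun x => σ x = x), A y z * A z y' = 77 ∧
      ∑ z ∈ univ \ univ.filter (fun x => σ x = x), (1 - 2 * A y z) * (1 - 2 * A y' z) = 0) ∧
    (∀ y, σ y = y → ∀ z (j : ℕ), A y ((σ ^ j) z) = A y z) := by
  obtain ⟨hf, hdeg, hlm⟩ := aut_order11_fixed_srg hV A h01 hsymm hdiag hk hsrg σ hσ hσ1 hA
  obtain ⟨h1, h2⟩ := fixed_conference_block hV A h01 hsymm hk hsrg _ (k' := 12) (μ' := 6)
    (by rw [hf]; norm_num) (by rw [hf]; norm_num) hdeg (hlm_of_fixed_srg A _ hlm (by norm_num))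
  refine ⟨hf, ?_, fun y hy => ?_, fun y hy y' hy' hne => ?_, fun y hy z j => aut_fixed_row_orbit_constant A σ hA hy z j⟩
  · rw [Finset.card_sdiff_of_subset (Finset.subset_univ _), Finset.card_univ, hV, hf]
  · obtain ⟨a, b⟩ := h1 y hy; exact ⟨by rw [a]; norm_num, b⟩
  · obtain ⟨a, b⟩ := h2 y hy y' hy' hne; exact ⟨by rw [a]; norm_num, b⟩

/-- **Order `7` with `25` fixed points: the `25 × 308` block** — `154 = 22·7` moved neighbours per fixed vertex, `77 = 11·7` common,
orthogonal Seidel rows: compressed, a `26 × 44` partial Hadamard matrix. -/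
theorem aut_order7_fixed25_block (hV : Fintype.card V = 333) (A : Matrix V V ℤ)
    (h01 : ∀ x y, A x y = 0 ∨ A x y = 1) (hsymm : ∀ x y, A y x = A x y) (hdiag : ∀ x, A x x = 0)
    (hk : ∀ x, ∑ y, A x y = 166) (hsrg : ∀ x y, ∑ z, A x z * A z y = 83 * (1 + (if x = y then 1 else 0)) - A x y)
    (σ : Equiv.Perm V) (hσ : σ ^ 7 = 1) (hA : ∀ x y, A (σ x) (σ y) = A x y)
    (hf : (univ.filter fun x => σ x = x).card = 25) :
    (∀ y ∈ univ.filter (fun x => σ x = x),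
      ∑ z ∈ univ \ univ.filter (fun x => σ x = x), A y z = 154 ∧
      ∑ z ∈ univ \ univ.filter (fun x => σ x = x), (1 - 2 * A y z) = 0) ∧
    (∀ y ∈ univ.filter (fun x => σ x = x), ∀ y' ∈ univ.filter (fun x => σ x = x), y ≠ y' →
      ∑ z ∈ univ \ univ.filter (fun x => σ x = x), A y z * A z y' = 77 ∧
      ∑ z ∈ univ \ univ.filter (fun x => σ x = x), (1 - 2 * A y z) * (1 - 2 * A y' z) = 0) := by
  obtain ⟨hdeg, hlm⟩ := aut_order7_fixed25_srg A h01 hsymm hdiag hk hsrg σ (e := 1) (by simpa using hσ) hA hf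
  obtain ⟨h1, h2⟩ := fixed_conference_block hV A h01 hsymm hk hsrg _ (k' := 12) (μ' := 6)
    (by rw [hf]; norm_num) (by rw [hf]; norm_num) hdeg (hlm_of_fixed_srg A _ hlm (by norm_num))
  refine ⟨fun y hy => ?_, fun y hy y' hy' hne => ?_⟩
  · obtain ⟨a, b⟩ := h1 y hy; exact ⟨by rw [a]; norm_num, b⟩
  · obtain ⟨a, b⟩ := h2 y hy y' hy' hne; exact ⟨by rw [a]; norm_num, b⟩

/-- **Order `5` with `13` fixed points: the `13 × 320` block** — `160 = 32·5` moved neighbours per fixed vertex, `80 = 16·5` common,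
orthogonal Seidel rows: compressed, a `14 × 64` partial Hadamard matrix. -/
theorem aut_order5_fixed13_block (hV : Fintype.card V = 333) (A : Matrix V V ℤ)
    (h01 : ∀ x y, A x y = 0 ∨ A x y = 1) (hsymm : ∀ x y, A y x = A x y) (hdiag : ∀ x, A x x = 0)
    (hk : ∀ x, ∑ y, A x y = 166) (hsrg : ∀ x y, ∑ z, A x z * A z y = 83 * (1 + (if x = y then 1 else 0)) - A x y)
    (σ : Equiv.Perm V) (hσ : σ ^ 5 = 1) (hA : ∀ x y, A (σ x) (σ y) = A x y)
    (hf : (univ.filter fun x => σ x = x).card = 13) :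
    (∀ y ∈ univ.filter (fun x => σ x = x),
      ∑ z ∈ univ \ univ.filter (fun x => σ x = x), A y z = 160 ∧
      ∑ z ∈ univ \ univ.filter (fun x => σ x = x), (1 - 2 * A y z) = 0) ∧
    (∀ y ∈ univ.filter (fun x => σ x = x), ∀ y' ∈ univ.filter (fun x => σ x = x), y ≠ y' →
      ∑ z ∈ univ \ univ.filter (fun x => σ x = x), A y z * A z y' = 80 ∧
      ∑ z ∈ univ \ univ.filter (fun x => σ x = x), (1 - 2 * A y z) * (1 - 2 * A y' z) = 0) := by
  obtain ⟨hdeg, hlm⟩ := aut_order5_fixed13_srg A h01 hsymm hdiag hk hsrg σ (e := 1) (by simpa using hσ) hA hf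
  obtain ⟨h1, h2⟩ := fixed_conference_block hV A h01 hsymm hk hsrg _ (k' := 6) (μ' := 3)
    (by rw [hf]; norm_num) (by rw [hf]; norm_num) hdeg (hlm_of_fixed_srg A _ hlm (by norm_num))
  refine ⟨fun y hy => ?_, fun y hy y' hy' hne => ?_⟩
  · obtain ⟨a, b⟩ := h1 y hy; exact ⟨by rw [a]; norm_num, b⟩
  · obtain ⟨a, b⟩ := h2 y hy y' hy' hne; exact ⟨by rw [a]; norm_num, b⟩

/-- **Order `3` (or any `3`-power order) with `9` fixed points: the `9 × 324` block** — `162 = 54·3` moved neighbours per fixed vertex,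
`81 = 27·3` common, orthogonal Seidel rows: compressed (order `3`), a `10 × 108` partial Hadamard matrix. -/
theorem aut_order3_fixed9_block (hV : Fintype.card V = 333) (A : Matrix V V ℤ)
    (h01 : ∀ x y, A x y = 0 ∨ A x y = 1) (hsymm : ∀ x y, A y x = A x y) (hdiag : ∀ x, A x x = 0)
    (hk : ∀ x, ∑ y, A x y = 166) (hsrg : ∀ x y, ∑ z, A x z * A z y = 83 * (1 + (if x = y then 1 else 0)) - A x y)
    (σ : Equiv.Perm V) {e : ℕ} (hσ : σ ^ (3 ^ e) = 1) (hA : ∀ x y, A (σ x) (σ y) = A x y)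
    (hf : (univ.filter fun x => σ x = x).card = 9) :
    (∀ y ∈ univ.filter (fun x => σ x = x),
      ∑ z ∈ univ \ univ.filter (fun x => σ x = x), A y z = 162 ∧
      ∑ z ∈ univ \ univ.filter (fun x => σ x = x), (1 - 2 * A y z) = 0) ∧
    (∀ y ∈ univ.filter (fun x => σ x = x), ∀ y' ∈ univ.filter (fun x => σ x = x), y ≠ y' →
      ∑ z ∈ univ \ univ.filter (fun x => σ x = x), A y z * A z y' = 81 ∧
      ∑ z ∈ univ \ univ.filter (fun x => σ x = x), (1 - 2 * A y z) * (1 - 2 * A y' z) = 0) := by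
  obtain ⟨hdeg, hlm⟩ := aut_order3_fixed9_srg A h01 hsymm hdiag hk hsrg σ hσ hA hf
  obtain ⟨h1, h2⟩ := fixed_conference_block hV A h01 hsymm hk hsrg _ (k' := 4) (μ' := 2)
    (by rw [hf]; norm_num) (by rw [hf]; norm_num) hdeg (hlm_of_fixed_srg A _ hlm (by norm_num))
  refine ⟨fun y hy => ?_, fun y hy y' hy' hne => ?_⟩
  · obtain ⟨a, b⟩ := h1 y hy; exact ⟨by rw [a]; norm_num, b⟩
  · obtain ⟨a, b⟩ := h2 y hy y' hy' hne; exact ⟨by rw [a]; norm_num, b⟩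

end fixedBlock

end Summit.Ventures.DiscreteObjects.Hadamard
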